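import Summits.CriticalPhenomena.PercolationContinuityZ3.Theorems.PercNearOneGluingNoHeavyLowerTailThreeCopyFibre
import Mathlib.Tactic.Ring
import Mathlib.Tactic.Positivity
import HarnessLib

/-!
# `NoHeavyLowerTail` (stmt-CriticalPhenomena-4575) — the two BLOB SKELETONS on which `H_{q+t}` is an identity

Support file (prover prim-ineq-gen-1 gen 4, new-inequality factory; `--supports stmt-CriticalPhenomena-4575`).  Pure algebra, no
definitions, no named facts, no sorries.  It generalises the single-edge identities `ha_star`, `hb_triangle`, `hb_star`, `ha_triangle`
of `…CubicThreePointTightFamilies` (arm weight `x`, complement `1 − x`) to INDEPENDENT blob weights `(p_e, q_e)`: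
a *blob* is an arbitrary two-terminal sub-network on a skeleton edge `e`, `p_e` the weight (or generating polynomial) of the blob
configurations that connect its two ends and `q_e` that of those that do not — no relation between `p_e` and `q_e` is assumed.

BLOB STAR (hub `h`, arms `a–h, b–h, c–h` carrying blobs `1,2,3`): the five cells of the three-terminal law are
`t = p₁p₂p₃`, `u₁ = q₁p₂p₃` (only `b ~ c`), `u₂ = p₁q₂p₃`, `u₃ = p₁p₂q₃`, `q = q₁q₂q₃ + p₁q₂q₃ + q₁p₂q₃ + q₁q₂p₃`.
BLOB TRIANGLE (sides `bc, ac, ab` carrying blobs `1,2,3`): `t = p₁p₂p₃ + q₁p₂p₃ + p₁q₂p₃ + p₁p₂q₃`, `uᵢ = pᵢ qⱼ q_k`, `q = q₁q₂q₃`.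
With `AG := qt − e₂(u)`, `Ha := t·AG − e₃(u)`, `Hb := q·AG − e₃(u)`, `H_{q+t} := (q+t)·AG − e₃(u)` (= `ThreeCopy.hqt q u₁ u₂ u₃ t`):
* `ag_blobStar`, `ag_blobTriangle` :  `AG = (p₁p₂p₃)(q₁q₂q₃)` on both skeletons;
* `ha_blobStar` : `Ha = 0`;  `hb_blobTriangle` : `Hb = 0`  (the two sheets of SF3-Hmax, now for arbitrary blobs);
* `hqt_blobStar` : `H_{q+t} = (p₁p₂p₃)(q₁q₂q₃)·q`;  `hqt_blobTriangle` : `H_{q+t} = (p₁p₂p₃)(q₁q₂q₃)·t`;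
* `hb_blobStar` : `Hb = (p₁p₂p₃)(q₁q₂q₃)·(q − p₁p₂p₃)` (NOT a nonnegative combination of blob monomials: the coefficientwise statement
  'Conjecture D' fails on blob stars — seat memo FINDING-7), dually `ha_blobTriangle`;
* `hqt_blobStar_nonneg`, `hqt_blobTriangle_nonneg` : `H_{q+t} ≥ 0` for nonnegative blob weights.
Reading `p_e, q_e` as the generating polynomials (nonnegative integer coefficients) of the blob's connecting / non-connecting
configurations, the identities say that every three-copy fibre sum of `H_{q+t}` (the hypothesis of `ThreeCopy.hqt_nonneg_of_fibres`)
is a coefficient of `Πp·Πq·q` resp. `Πp·Πq·t`, hence ≥ 0 and frequently = 0: all nontrivially tight fibres observed in the seat's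
census (memo FINDING-8 §2) are zeros of these two products. [this work]
-/

namespace Summit.CriticalPhenomena.PercolationContinuityZ3.Theorems

namespace BlobSkeleton

section Ring

variable {R : Type*} [CommRing R]

/-- **Blob star: `AG = qt − e₂(u) = (p₁p₂p₃)(q₁q₂q₃)`.** [this work] -/
theorem ag_blobStar (p₁ p₂ p₃ q₁ q₂ q₃ : R) :
    (q₁ * q₂ * q₃ + p₁ * q₂ * q₃ + q₁ * p₂ * q₃ + q₁ * q₂ * p₃) * (p₁ * p₂ * p₃) -
        ((q₁ * p₂ * p₃) * (p₁ * q₂ * p₃) + (q₁ * p₂ * p₃) * (p₁ * p₂ * q₃) + (p₁ * q₂ * p₃) * (p₁ * p₂ * q₃)) =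
      (p₁ * p₂ * p₃) * (q₁ * q₂ * q₃) := by
  ring

/-- **Blob star sheet: `Ha = t·(qt − e₂) − e₃ = 0`** for arbitrary blob weights. [this work] -/
theorem ha_blobStar (p₁ p₂ p₃ q₁ q₂ q₃ : R) :
    (p₁ * p₂ * p₃) *
          ((q₁ * q₂ * q₃ + p₁ * q₂ * q₃ + q₁ * p₂ * q₃ + q₁ * q₂ * p₃) * (p₁ * p₂ * p₃) -
            ((q₁ * p₂ * p₃) * (p₁ * q₂ * p₃) + (q₁ * p₂ * p₃) * (p₁ * p₂ * q₃) + (p₁ * q₂ * p₃) * (p₁ * p₂ * q₃))) -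
        (q₁ * p₂ * p₃) * (p₁ * q₂ * p₃) * (p₁ * p₂ * q₃) = 0 := by
  ring

/-- **Blob star: `Hb = q·(qt − e₂) − e₃ = (p₁p₂p₃)(q₁q₂q₃)·(q − p₁p₂p₃)`** — the factor `q − t` has mixed-sign blob
coefficients. [this work] -/
theorem hb_blobStar (p₁ p₂ p₃ q₁ q₂ q₃ : R) :
    (q₁ * q₂ * q₃ + p₁ * q₂ * q₃ + q₁ * p₂ * q₃ + q₁ * q₂ * p₃) *
          ((q₁ * q₂ * q₃ + p₁ * q₂ * q₃ + q₁ * p₂ * q₃ + q₁ * q₂ * p₃) * (p₁ * p₂ * p₃) -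
            ((q₁ * p₂ * p₃) * (p₁ * q₂ * p₃) + (q₁ * p₂ * p₃) * (p₁ * p₂ * q₃) + (p₁ * q₂ * p₃) * (p₁ * p₂ * q₃))) -
        (q₁ * p₂ * p₃) * (p₁ * q₂ * p₃) * (p₁ * p₂ * q₃) =
      (p₁ * p₂ * p₃) * (q₁ * q₂ * q₃) *
        ((q₁ * q₂ * q₃ + p₁ * q₂ * q₃ + q₁ * p₂ * q₃ + q₁ * q₂ * p₃) - p₁ * p₂ * p₃) := by
  ring

/-- **Blob star: `H_{q+t} = (p₁p₂p₃)(q₁q₂q₃)·q`** (`ThreeCopy.hqt b c₁ c₂ c₃ a = (a+b)(ab − e₂(c)) − e₃(c)`). [this work] -/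
theorem hqt_blobStar (p₁ p₂ p₃ q₁ q₂ q₃ : ℝ) :
    ThreeCopy.hqt (q₁ * q₂ * q₃ + p₁ * q₂ * q₃ + q₁ * p₂ * q₃ + q₁ * q₂ * p₃) (q₁ * p₂ * p₃) (p₁ * q₂ * p₃) (p₁ * p₂ * q₃)
        (p₁ * p₂ * p₃) =
      (p₁ * p₂ * p₃) * (q₁ * q₂ * q₃) * (q₁ * q₂ * q₃ + p₁ * q₂ * q₃ + q₁ * p₂ * q₃ + q₁ * q₂ * p₃) := by
  unfold ThreeCopy.hqt
  ring

/-- **Blob triangle: `AG = (p₁p₂p₃)(q₁q₂q₃)`.** [this work] -/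
theorem ag_blobTriangle (p₁ p₂ p₃ q₁ q₂ q₃ : R) :
    (q₁ * q₂ * q₃) * (p₁ * p₂ * p₃ + q₁ * p₂ * p₃ + p₁ * q₂ * p₃ + p₁ * p₂ * q₃) -
        ((p₁ * q₂ * q₃) * (q₁ * p₂ * q₃) + (p₁ * q₂ * q₃) * (q₁ * q₂ * p₃) + (q₁ * p₂ * q₃) * (q₁ * q₂ * p₃)) =
      (p₁ * p₂ * p₃) * (q₁ * q₂ * q₃) := by
  ring

/-- **Blob triangle sheet: `Hb = q·(qt − e₂) − e₃ = 0`** for arbitrary blob weights. [this work] -/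
theorem hb_blobTriangle (p₁ p₂ p₃ q₁ q₂ q₃ : R) :
    (q₁ * q₂ * q₃) *
          ((q₁ * q₂ * q₃) * (p₁ * p₂ * p₃ + q₁ * p₂ * p₃ + p₁ * q₂ * p₃ + p₁ * p₂ * q₃) -
            ((p₁ * q₂ * q₃) * (q₁ * p₂ * q₃) + (p₁ * q₂ * q₃) * (q₁ * q₂ * p₃) + (q₁ * p₂ * q₃) * (q₁ * q₂ * p₃))) -
        (p₁ * q₂ * q₃) * (q₁ * p₂ * q₃) * (q₁ * q₂ * p₃) = 0 := by
  ring

/-- **Blob triangle: `Ha = t·(qt − e₂) − e₃ = (p₁p₂p₃)(q₁q₂q₃)·(t − q₁q₂q₃)`.** [this work] -/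
theorem ha_blobTriangle (p₁ p₂ p₃ q₁ q₂ q₃ : R) :
    (p₁ * p₂ * p₃ + q₁ * p₂ * p₃ + p₁ * q₂ * p₃ + p₁ * p₂ * q₃) *
          ((q₁ * q₂ * q₃) * (p₁ * p₂ * p₃ + q₁ * p₂ * p₃ + p₁ * q₂ * p₃ + p₁ * p₂ * q₃) -
            ((p₁ * q₂ * q₃) * (q₁ * p₂ * q₃) + (p₁ * q₂ * q₃) * (q₁ * q₂ * p₃) + (q₁ * p₂ * q₃) * (q₁ * q₂ * p₃))) -
        (p₁ * q₂ * q₃) * (q₁ * p₂ * q₃) * (q₁ * q₂ * p₃) =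
      (p₁ * p₂ * p₃) * (q₁ * q₂ * q₃) *
        ((p₁ * p₂ * p₃ + q₁ * p₂ * p₃ + p₁ * q₂ * p₃ + p₁ * p₂ * q₃) - q₁ * q₂ * q₃) := by
  ring

/-- **Blob triangle: `H_{q+t} = (p₁p₂p₃)(q₁q₂q₃)·t`.** [this work] -/
theorem hqt_blobTriangle (p₁ p₂ p₃ q₁ q₂ q₃ : ℝ) :
    ThreeCopy.hqt (q₁ * q₂ * q₃) (p₁ * q₂ * q₃) (q₁ * p₂ * q₃) (q₁ * q₂ * p₃)
        (p₁ * p₂ * p₃ + q₁ * p₂ * p₃ + p₁ * q₂ * p₃ + p₁ * p₂ * q₃) =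
      (p₁ * p₂ * p₃) * (q₁ * q₂ * q₃) * (p₁ * p₂ * p₃ + q₁ * p₂ * p₃ + p₁ * q₂ * p₃ + p₁ * p₂ * q₃) := by
  unfold ThreeCopy.hqt
  ring

end Ring

/-- **`H_{q+t} ≥ 0` on every blob star** with nonnegative blob weights. [this work] -/
theorem hqt_blobStar_nonneg {p₁ p₂ p₃ q₁ q₂ q₃ : ℝ} (hp₁ : 0 ≤ p₁) (hp₂ : 0 ≤ p₂) (hp₃ : 0 ≤ p₃)
    (hq₁ : 0 ≤ q₁) (hq₂ : 0 ≤ q₂) (hq₃ : 0 ≤ q₃) :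
    0 ≤ ThreeCopy.hqt (q₁ * q₂ * q₃ + p₁ * q₂ * q₃ + q₁ * p₂ * q₃ + q₁ * q₂ * p₃) (q₁ * p₂ * p₃) (p₁ * q₂ * p₃)
        (p₁ * p₂ * q₃) (p₁ * p₂ * p₃) := by
  rw [hqt_blobStar]
  positivity

/-- **`H_{q+t} ≥ 0` on every blob triangle** with nonnegative blob weights. [this work] -/
theorem hqt_blobTriangle_nonneg {p₁ p₂ p₃ q₁ q₂ q₃ : ℝ} (hp₁ : 0 ≤ p₁) (hp₂ : 0 ≤ p₂) (hp₃ : 0 ≤ p₃)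
    (hq₁ : 0 ≤ q₁) (hq₂ : 0 ≤ q₂) (hq₃ : 0 ≤ q₃) :
    0 ≤ ThreeCopy.hqt (q₁ * q₂ * q₃) (p₁ * q₂ * q₃) (q₁ * p₂ * q₃) (q₁ * q₂ * p₃)
        (p₁ * p₂ * p₃ + q₁ * p₂ * p₃ + p₁ * q₂ * p₃ + p₁ * p₂ * q₃) := by
  rw [hqt_blobTriangle]
  positivity

end BlobSkeleton

end Summit.CriticalPhenomena.PercolationContinuityZ3.Theorems
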